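import Summits.ResolutionOfSingularities.ResolutionOfSingularities.Theorems.HilbertSamuelEliminationSigmaMaxModificationsCorridor3WLadderStrataHalfThmIV
import Summits.ResolutionOfSingularities.ResolutionOfSingularities.Theorems.HilbertSamuelEliminationSigmaMaxModificationsCorridor3WLadderSegmentsAssemblyC
import HarnessLib

/-!
# [OURS · L1 W4.2] THE REGISTERED STUB `stub_Wlow3M_char` IS A THEOREM MODULO FOUR PRINTED NAMED FACTS — NO OURS HYPOTHESIS LEFT; and the
# crux conjunct `SigmaMaxModificationsCorridor3` from print and THREE OURS rows (`Wlow3TwoM`, `Wtop3PointedM`, `Wtop3NonpointedM`)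

Crux chain w42 (`SigmaMaxModifications`, stmt-ResolutionOfSingularities-18506; conjunct `SigmaMaxModificationsCorridor3`,
stmt-ResolutionOfSingularities-19249; line v8.3 `w_ladder_elim`, registered stub `stub_Wlow3M_char : ∀ p, p.Prime → Wlow3CharM p`), seat
res-L1-w42-stub-4 (gen 5). OURS (cell res-hironaka, slot W4.2); NOT statements of H. Hironaka's manuscript [Hironaka2017] nor of
[CossartJannsenSaito2020]; AI-drafted, weaker than expert review. PURE COMPOSITION by name (no definition): this seat's four-fact socket
`stub_Wlow3M_char_of_thmIV_of_extractionLoc` (p532193: the STRATA HALF from Cor. 6.37 loc / Thm. 6.40 loc-iso / Thm. 3.10 (4) / [H4] Th. IV) fed with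
res-L1-w42-stub-1's UNITS HALF `Moving.unitTowerExtractionLocQM_of_printedFacts` (p537170, `…SegmentsAssemblyB`: the unit-tower extraction from
Thm. 3.14 point-locus / numerical / near-fibre, Thm. 3.6, Thm. 3.10 (4)) whose three Thm. 3.14 inputs are DERIVED from [H4] Th. IV (stub-3 / res-type-031)
and whose Thm. 3.6 is the tree theorem `CossartJannsenSaito2020_thm_3_6_holds` (res-type-064). Helper file `--supports stmt-ResolutionOfSingularities-19249`;
credits nothing by itself — the row stays CONDITIONAL on the four printed named facts (statement-only Literature facts), and closes BY NAME the day they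
are theorems or the skeleton moves them into `stub_printedFactsL`.

* **`stub_Wlow3M_char_of_printedFacts : Corollary637_char → KeyTheorem640_char_localized_isolated → CossartJannsenSaito2020_thm_3_10_4 →
  Hironaka1970_thmIV → ∀ p, p.Prime → Wlow3CharM p`** — FOUR printed facts, NOTHING else.
* `Residue.sigmaMaxModificationsCorridor3_of_printed_of_three_rows` — stub-1's `…_of_printed_of_rows4Loc` (p538617) with the strata row FED by
  `wlow3CharStrataM_row_of_thmIV` and the Thm. 3.14 / Thm. 3.6 binders derived: printed {ν-elimination of surfaces, CJS sequences permissible, Thm. 3.10 (4),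
  Thm. 6.40 loc-iso, Cor. 6.37, [H4] Th. IV} + OURS rows {`Wlow3TwoM`, `Wtop3PointedM`, `Wtop3NonpointedM`}.

References: CJS LNM 2270 Thm. 3.6, Thm. 3.10 (4), Thm. 3.14, Def. 6.34, Thm. 6.35, Cor. 6.37, Def. 6.38, Thm. 6.40, p. 107 [CossartJannsenSaito2020];
Hironaka 1970 Th. IV [Hironaka1970NumericalCharacters]; tree p532193 (this seat), p537170 / p538617 (res-L1-w42-stub-1), p525927 / p528432 (res-L1-w42-stub-3),
p527233 (res-type-031), p529537 (res-type-064), p518484 (res-D-lib-1).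
-/

noncomputable section

-- plan-1/idea-2 module setting kept (namespace `…Corridor3.Moving` re-enters `…Corridor3`)
set_option linter.dupNamespace false

open CategoryTheory CategoryTheory.Limits AlgebraicGeometry TopologicalSpace Topology IsLocalRing
open Summit.ResolutionOfSingularities.ResolutionOfSingularities.Theorems.CampaignW42
open Literature.AlgebraicGeometry.Resolution Literature.RingTheory.HilbertSamuel
open Literature.AlgebraicGeometry.CossartJannsenSaito2020
open Summit.ResolutionOfSingularities.ResolutionOfSingularities.Theses.HilbertSamuelElimination
open Summit.ResolutionOfSingularities.ResolutionOfSingularities.Theorems.SigmaMaxModificationsCorridor3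

namespace Summit.ResolutionOfSingularities.ResolutionOfSingularities.Theorems.SigmaMaxModificationsCorridor3.Moving

/-- **The (F1)-regime unit-tower extraction from TWO printed facts**: stub-1's `unitTowerExtractionLocQM_of_printedFacts` with its Thm. 3.14 inputs
(point locus, numerical, near fibre) DERIVED from [H4] Th. IV and Thm. 3.6 supplied by the tree theorem. [cite: CossartJannsenSaito2020, Thm. 3.14, Thm. 3.6, Thm. 3.10 (4), Def. 6.38, Thm. 6.40] -/
theorem unitTowerExtractionLocQM_of_thmIV (h310 : CossartJannsenSaito2020_thm_3_10_4.{0}) (h51 : Hironaka1970_thmIV.{0}) (p : ℕ) :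
    UnitTowerExtractionLocQM p :=
  unitTowerExtractionLocQM_of_printedFacts p (Directrix214Sharp.thm314_point_locus_of_thmIV h51)
    (cossartJannsenSaito2020_thm_3_14_of_thmIV_of_split h51 HerrmannIkedaOrbanz1988_cor_21_11_holds)
    (thm314_nearFibre_subsingleton_of_thmIV h51) CossartJannsenSaito2020_thm_3_6_holds h310

/-- **THE REGISTERED STUB `stub_Wlow3M_char : ∀ p, p.Prime → Wlow3CharM p` IS A THEOREM MODULO FOUR PRINTED NAMED FACTS AND NOTHING ELSE** —
`Corollary637_char` (CJS Cor. 6.37, (F1)), `KeyTheorem640_char_localized_isolated` (CJS Thm. 6.40, unit-wise localised, isolated), `CossartJannsenSaito2020_thm_3_10_4`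
(CJS Thm. 3.10 (4)), `Hironaka1970_thmIV` ([H4] Th. IV, general permissible centre). The strata half (this seat, p532193) and the units half (stub-1,
p537170) contribute NO OURS hypothesis. [cite: CossartJannsenSaito2020, Thm. 3.10 (4), Thm. 3.14, Thm. 6.35, Cor. 6.37, Thm. 6.40, p. 107] -/
theorem stub_Wlow3M_char_of_printedFacts (hC637 : Corollary637_char.{0}) (hK : KeyTheorem640_char_localized_isolated.{0})
    (h310 : CossartJannsenSaito2020_thm_3_10_4.{0}) (h51 : Hironaka1970_thmIV.{0}) : ∀ p : ℕ, p.Prime → Wlow3CharM.{0} p :=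
  stub_Wlow3M_char_of_thmIV_of_extractionLoc hC637 hK h310 h51 fun p _ => unitTowerExtractionLocQM_of_thmIV h310 h51 p

/-- **The char row at one prime, same four facts.** [cite: CossartJannsenSaito2020, Thm. 3.10 (4), Cor. 6.37, Thm. 6.40] -/
theorem wlow3CharM_of_printedFacts' (hC637 : Corollary637_char.{0}) (hK : KeyTheorem640_char_localized_isolated.{0})
    (h310 : CossartJannsenSaito2020_thm_3_10_4.{0}) (h51 : Hironaka1970_thmIV.{0}) (p : ℕ) : Wlow3CharM.{0} p :=
  wlow3CharM_of_thmIV_of_extractionLoc hC637 hK h310 h51 (unitTowerExtractionLocQM_of_thmIV h310 h51 p)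

end Summit.ResolutionOfSingularities.ResolutionOfSingularities.Theorems.SigmaMaxModificationsCorridor3.Moving

namespace Summit.ResolutionOfSingularities.ResolutionOfSingularities.Theorems.SigmaMaxModificationsCorridor3.Residue

open Summit.ResolutionOfSingularities.ResolutionOfSingularities.Theorems.SigmaMaxModificationsCorridor3.Moving

/-- **THE CRUX CONJUNCT `SigmaMaxModificationsCorridor3` FROM SIX PRINTED NAMED FACTS AND THREE OURS ROWS** — stub-1's
`sigmaMaxModificationsCorridor3_of_printed_of_rows4Loc` (p538617) with the strata row `∀ p, p.Prime → Wlow3CharStrataM p` FED (`wlow3CharStrataM_row_of_thmIV`,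
p532193) and the Thm. 3.14 ×3 / Thm. 3.6 binders derived from [H4] Th. IV / the tree. Printed: ν-elimination of surfaces, CJS sequences permissible,
Thm. 3.10 (4), Thm. 6.40 (loc-iso), Cor. 6.37, [H4] Th. IV. OURS rows left: `Wlow3TwoM` (p = 2), `Wtop3PointedM`, `Wtop3NonpointedM`. CONDITIONAL —
credits nothing. [cite: CossartJannsenSaito2020, Thm. 1.2, Thm. 3.10 (4), Thm. 3.14, Cor. 6.37, Thm. 6.40, p. 107] -/
theorem sigmaMaxModificationsCorridor3_of_printed_of_three_rows
    (hNu : CossartJannsenSaito2020_nuElimination.{0}) (hSeq : CossartJannsenSaito2020SequencePermissible.{0})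
    (h310 : CossartJannsenSaito2020_thm_3_10_4.{0}) (hK : KeyTheorem640_char_localized_isolated.{0}) (hC : Corollary637_char.{0})
    (h51 : Hironaka1970_thmIV.{0}) (hTwo : ∀ p : ℕ, p.Prime → Wlow3TwoM.{0} p)
    (hTopP : ∀ p : ℕ, p.Prime → Wtop3PointedM.{0} p) (hTopN : ∀ p : ℕ, p.Prime → Wtop3NonpointedM.{0} p) :
    SigmaMaxModificationsCorridor3 :=
  sigmaMaxModificationsCorridor3_of_printed_of_rows4Loc hNu hSeq h310 hK hC
    (cossartJannsenSaito2020_thm_3_14_of_thmIV_of_split h51 HerrmannIkedaOrbanz1988_cor_21_11_holds)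
    (Directrix214Sharp.thm314_point_locus_of_thmIV h51) (thm314_nearFibre_subsingleton_of_thmIV h51) CossartJannsenSaito2020_thm_3_6_holds
    (wlow3CharStrataM_row_of_thmIV hC.toLoc hK h310 h51) hTwo hTopP hTopN

end Summit.ResolutionOfSingularities.ResolutionOfSingularities.Theorems.SigmaMaxModificationsCorridor3.Residue

end
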